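/-
Copyright (c) 2026. All rights reserved.
Released under Apache 2.0 license as described in the file LICENSE.
-/
import Literature.Geometry.Riemannian.GaussBonnetLocal
import Literature.Geometry.Riemannian.GaussBonnetGradient
import Literature.Geometry.Lorentzian.CurvatureRegularity
import Literature.Topology.FourManifolds.SphereMorseCount
import Literature.Topology.FourManifolds.MorseExistence
import Literature.Topology.FourManifolds.MorseProofs
import Literature.Topology.FourManifolds.SurfaceMorseCountLeTwo
import HarnessLib

/-!
# The Gauss–Bonnet theorem for compact surfaces

[scope: pseudo-Riemannian/manifold]

J. M. Lee, *Introduction to Riemannian Manifolds*, 2nd ed. (2018), Thm. 9.7 (the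
**Gauss–Bonnet theorem**): *if `(M, g)` is a compact Riemannian `2`-manifold then
`∫_M K dA = 2π χ(M)`*, with `K = S/2` the Gaussian curvature (Cor. 8.28) and `χ(M)` the Euler
characteristic. We PROVE it here in the form

  `∫_M S dA = 4π χ(M)`,  `χ(M) = relEuler ℤ ℤ M ∅ = Σ_k (-1)^k rank H_k(M; ℤ)`,

for every compact Hausdorff `2`-manifold `M` modelled on `ℝ²` and every smooth Riemannian metric,
by the **Poincaré–Hopf route** (Chern's intrinsic argument, in an orientation-free form):

1. Take a Morse function `f` on `M` (`exists_isMorse_holds`) and its gradient `Y = grad f`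
   (`GaussBonnetGradient.lean`); `Y` has finitely many zeros, the critical points of `f`
   (`IsMorse.finite_criticalSet_holds`).
2. Off the zeros, the field `X = (∇_Y Y − (div Y) Y)/g(Y, Y)` has divergence `S/2`
   (`vectorDivergence_normalizedAcceleration`, `CurvatureAsDivergence.lean`; this is
   `K dA = d ω₁₂` written without a frame).
3. Cut `X` off near the zeros with the transported cutoffs `χ_r` of `TransportedCutoff.lean` and
   apply the divergence theorem (`integral_vectorDivergence_eq_zero`, `DivergenceTheorem.lean`):
   `∫ χ_r S/2 dA = −Σ_p ∫ dχ_r^p (X) dA`.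
4. Each flux tends to `−2π · sign det DŶ(p)` as `r → 0` with an `O(r)` error
   (`abs_integral_mvfderiv_mcutoff_add_le`, `GaussBonnetLocal.lean`), and
   `sign det DŶ(p) = (−1)^{index_p f}` (`exists_linearization_grad`); the cutoff regions have
   area `O(r²)` (`measureReal_mcutoffSupport_le`).
5. Hence `∫ S dA = 4π Σ_p (−1)^{index_p f} = 4π χ(M)` by the Morse count of a closed manifold
   (`SphereMorseCount.morseCount_eq_relEuler`).

Main statements:

* `integral_scalarCurvature_eq_relEuler` — for a Mathlib `ContMDiffRiemannianMetric` `G`: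
  `∫ (ofRiemannian G).scalarCurvature ∂(riemannianVolume G 2) = 4π relEuler ℤ ℤ M ∅`;
* `gaussBonnet` — the same for a Riemannian `PseudoRiemannianMetric` `g` and the measure
  `riemannianVolume (g.toContMDiffRiemannianMetric hg) 2`;
* `integral_scalarCurvature_le`, `integral_scalarCurvature_ofRiemannian_le` — **`∫_M S dA ≤ 8π` for
  a compact connected surface** (`χ(M) ≤ 2`, `relEuler_surface_le_two`), the topological input of
  the Monotonicity Calculation of Huisken–Ilmanen 2001, §5
  (`geroch_monotonicity_smooth_of_gaussBonnet`, `IMCFMeanCurvatureEvolution.lean`).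

-- TODO(general form): arbitrary `2`-dimensional model spaces; compact surfaces with boundary
-- (Lee, Problem 9-10); the Gauss–Bonnet formula for curved polygons (Lee, Thm. 9.3).

## References

* J. M. Lee, *Introduction to Riemannian Manifolds*, 2nd ed., GTM 176, Springer 2018: Thm. 9.7
  (Gauss–Bonnet), p. 243 and Cor. 8.28 (`K = S/2`), pp. 277–278. [LeeRiemannianManifolds2018]
* S.-S. Chern, *A simple intrinsic proof of the Gauss–Bonnet formula for closed Riemannian
  manifolds*, Ann. of Math. 45 (1944), 747–752 (the vector-field proof).
* J. Milnor, *Topology from the differentiable viewpoint* (1965), §6 (Poincaré–Hopf).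
* A. Hatcher, *Algebraic Topology*, CUP 2002, Thm. 2.44 (`χ = Σ (-1)^k rank H_k`). [HatcherAT2002]
* G. Huisken, T. Ilmanen, *The inverse mean curvature flow and the Riemannian Penrose inequality*,
  J. Differential Geom. 59 (2001) 353–437, §5. [HuiskenIlmanenIMCF2001]
-/

open Bundle Set Metric Filter Function MeasureTheory Module
open ContMDiffRiemannianMetric Literature.Geometry.Lorentzian
open Literature.Geometry.Lorentzian.PseudoRiemannianMetric Literature.Geometry.Riemannian.IndexFlux
open Literature.Topology.FourManifolds Literature.AlgebraicTopology.SingularHomology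
open scoped ContDiff Manifold Topology RealInnerProductSpace Real

noncomputable section

universe u

namespace Literature.Geometry.Riemannian

/-! ### Elementary lemmas -/

section Elementary

/-- If `|a - b| ≤ K r` for all small `r > 0`, then `a = b`. [folklore] -/
theorem eq_of_abs_sub_le_mul {a b K r₁ : ℝ} (hr₁ : 0 < r₁)
    (h : ∀ r, 0 < r → r < r₁ → |a - b| ≤ K * r) : a = b := by
  by_contra hab
  have hd : 0 < |a - b| := abs_pos.2 (sub_ne_zero.2 hab)
  set r : ℝ := min (r₁ / 2) (|a - b| / (2 * (|K| + 1))) with hr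
  have hK1 : 0 < |K| + 1 := by positivity
  have hrpos : 0 < r := lt_min (by linarith) (by positivity)
  have hrlt : r < r₁ := (min_le_left _ _).trans_lt (by linarith)
  have h1 := h r hrpos hrlt
  have h2 : K * r ≤ |K| * r := mul_le_mul_of_nonneg_right (le_abs_self K) hrpos.le
  have h3 : |K| * r ≤ |K| * (|a - b| / (2 * (|K| + 1))) :=
    mul_le_mul_of_nonneg_left (min_le_right _ _) (abs_nonneg K)
  have h4 : |K| * (|a - b| / (2 * (|K| + 1))) < |a - b| := by
    rw [mul_div_assoc']
    rw [div_lt_iff₀ (by positivity)]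
    nlinarith [abs_nonneg K]
  linarith

variable {E : Type*} [NormedAddCommGroup E] [InnerProductSpace ℝ E]

/-- The cutoff takes values in `[0, 1]`. [folklore] -/
theorem cutoff_nonneg (T : E →L[ℝ] E) (c : E) (r : ℝ) (x : E) : 0 ≤ cutoff T c r x := by
  rw [cutoff_apply, profile]
  exact Real.smoothTransition.nonneg _

/-- The cutoff takes values in `[0, 1]`. [folklore] -/
theorem cutoff_le_one (T : E →L[ℝ] E) (c : E) (r : ℝ) (x : E) : cutoff T c r x ≤ 1 := by
  rw [cutoff_apply, profile]
  exact Real.smoothTransition.le_one _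

variable {H : Type*} [TopologicalSpace H] {I : ModelWithCorners ℝ E H}
  {N : Type*} [TopologicalSpace N] [ChartedSpace H N]

/-- The transported cutoff takes values in `[0, 1]`. [folklore] -/
theorem mcutoff_nonneg (p : N) (T : E →L[ℝ] E) (r : ℝ) (y : N) : 0 ≤ mcutoff I p T r y := by
  by_cases hy : y ∈ (extChartAt I p).source
  · rw [mcutoff_of_mem hy]; exact cutoff_nonneg _ _ _ _
  · rw [mcutoff_of_not_mem hy]; exact zero_le_one

/-- The transported cutoff takes values in `[0, 1]`. [folklore] -/
theorem mcutoff_le_one (p : N) (T : E →L[ℝ] E) (r : ℝ) (y : N) : mcutoff I p T r y ≤ 1 := by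
  by_cases hy : y ∈ (extChartAt I p).source
  · rw [mcutoff_of_mem hy]; exact cutoff_le_one _ _ _ _
  · rw [mcutoff_of_not_mem hy]

/-- `mvfderiv` of real functions respects eventual equality. [folklore] -/
theorem mvfderiv_congr_of_eventuallyEq' {f₁ f₂ : N → ℝ} {y : N}
    (h : f₁ =ᶠ[𝓝 y] f₂) (v : TangentSpace I y) : mvfderiv I f₁ y v = mvfderiv I f₂ y v := by
  rw [mvfderiv_real_apply, mvfderiv_real_apply, h.mfderiv_eq]
  rfl

end Elementary

/-! ### The Morse count as a sum over the critical points -/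

section MorseCount

variable {M : Type u} [TopologicalSpace M] [ChartedSpace (EuclideanSpace ℝ (Fin 2)) M]
  [IsManifold (𝓡 2) ∞ M] [CompactSpace M] [T2Space M] [SecondCountableTopology M]

/-- **The Morse count of a closed surface as a sum over critical points**:
`Σ_{p critical} (−1)^{index_p f} = χ(M)` (regrouping `SphereMorseCount.morseCount_eq_relEuler` by
the value of the index, which is `≤ 2`). [cite: MilnorHCobordism1965, §3 (PDF p. 21) and Thm. 7.4 (PDF p. 48)] -/
theorem sum_neg_one_pow_morseIndex_eq_relEuler {f : M → ℝ} (hf : IsMorse (𝓡 2) f)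
    (hfin : (criticalSet (𝓡 2) f).Finite) :
    ∑ p ∈ hfin.toFinset, (-1 : ℝ) ^ morseIndex (𝓡 2) f p = (relEuler ℤ ℤ M ∅ : ℝ) := by
  classical
  have hcount := SphereMorseCount.morseCount_eq_relEuler (n := 1) hf
  have hZ : (∑ p ∈ hfin.toFinset, (-1 : ℤ) ^ morseIndex (𝓡 2) f p) = relEuler ℤ ℤ M ∅ := by
    rw [← hcount]
    have hmaps : ∀ p ∈ hfin.toFinset, morseIndex (𝓡 2) f p ∈ Finset.range (1 + 2) := by
      intro p _
      rw [Finset.mem_range]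
      have := morseIndex_le_finrank (𝓡 2) f p
      rw [finrank_euclideanSpace_fin] at this
      omega
    rw [← Finset.sum_fiberwise_of_maps_to' hmaps (fun k ↦ (-1 : ℤ) ^ k)]
    refine Finset.sum_congr rfl fun k _ ↦ ?_
    rw [Finset.sum_const, nsmul_eq_mul, mul_comm]
    congr 1
    have hset : criticalSetOfIndex (𝓡 2) f k =
        ↑(hfin.toFinset.filter fun p ↦ morseIndex (𝓡 2) f p = k) := by
      ext p
      simp only [mem_criticalSetOfIndex, Finset.coe_filter, Set.Finite.mem_toFinset,
        mem_criticalSet, mem_setOf_eq]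
    rw [hset, Set.ncard_coe_finset]
  exact_mod_cast hZ

end MorseCount

/-! ### The Gauss–Bonnet theorem -/

section GaussBonnet

variable {M : Type u} [TopologicalSpace M] [ChartedSpace (EuclideanSpace ℝ (Fin 2)) M]
  [IsManifold (𝓡 2) ∞ M] [CompactSpace M] [T2Space M] [MeasurableSpace M] [BorelSpace M]

set_option backward.isDefEq.respectTransparency false in
set_option maxHeartbeats 1600000 in
/-- **The Gauss–Bonnet theorem, for a Mathlib Riemannian metric**: for a smooth
`ContMDiffRiemannianMetric` `G` on a compact surface `M` (Hausdorff, modelled on `ℝ²`),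
`∫_M S dμ_G = 4π χ(M)` with `S` the scalar curvature of `ofRiemannian G`, `μ_G` the Riemannian
measure and `χ(M) = relEuler ℤ ℤ M ∅`. Proof: Poincaré–Hopf route (module docstring).
[cite: LeeRiemannianManifolds2018, Thm. 9.7 (with Cor. 8.28)] -/
theorem integral_scalarCurvature_riemannianMeasure_eq
    (G : ContMDiffRiemannianMetric (𝓡 2) ∞ (EuclideanSpace ℝ (Fin 2))
      (TangentSpace (𝓡 2) : M → Type _)) [(ofRiemannian G).HasLeviCivita] :
    ∫ x, (ofRiemannian G).scalarCurvature x ∂riemannianMeasure G =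
      4 * π * (relEuler ℤ ℤ M ∅ : ℝ) := by
  classical
  letI : RiemannianBundle (fun x : M ↦ TangentSpace (𝓡 2) x) :=
    ⟨G.toContinuousRiemannianMetric.toRiemannianMetric⟩
  haveI : SecondCountableTopology M :=
    ChartedSpace.secondCountable_of_sigmaCompact (EuclideanSpace ℝ (Fin 2)) M
  -- notation
  set g := ofRiemannian G with hg
  set μ := riemannianMeasure G with hμ
  set S := g.scalarCurvature with hSdef
  have h2 : finrank ℝ (EuclideanSpace ℝ (Fin 2)) = 2 := finrank_euclideanSpace_fin
  have hgR : g.IsRiemannian := isRiemannian_ofRiemannian G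
  have hSc : Continuous S := (contMDiff_scalarCurvature g).continuous
  -- ### Step 1: a Morse function, its critical points, its gradient
  obtain ⟨f, hf⟩ := exists_isMorse_holds 2 M
  have hfs : ContMDiff (𝓡 2) 𝓘(ℝ, ℝ) ∞ f := hf.contMDiff
  have hCfin : (criticalSet (𝓡 2) f).Finite := IsMorse.finite_criticalSet_holds hf
  set C : Finset M := hCfin.toFinset with hCdef
  have hC : ∀ p, p ∈ C ↔ IsMCriticalPt (𝓡 2) f p := fun p ↦ by
    rw [hCdef, Set.Finite.mem_toFinset, mem_criticalSet]
  set Y : Π x : M, TangentSpace (𝓡 2) x := grad g f with hYdef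
  have hY : ContMDiff (𝓡 2) ((𝓡 2).prod 𝓘(ℝ, EuclideanSpace ℝ (Fin 2))) ∞ fun y ↦
      (TotalSpace.mk' (EuclideanSpace ℝ (Fin 2)) y (Y y) : TangentBundle (𝓡 2) M) :=
    contMDiff_grad g hfs
  have hY0 : ∀ x, Y x = 0 ↔ x ∈ C := fun x ↦ by
    rw [hC, hYdef, grad_eq_zero_iff]; rfl
  set X : Π x : M, TangentSpace (𝓡 2) x := normalizedAcceleration g Y with hXdef
  have hXs : ∀ x, x ∉ C → ContMDiffAt (𝓡 2) ((𝓡 2).prod 𝓘(ℝ, EuclideanSpace ℝ (Fin 2))) ∞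
      (fun y ↦ (TotalSpace.mk' (EuclideanSpace ℝ (Fin 2)) y (X y) : TangentBundle (𝓡 2) M)) x :=
    fun x hx ↦
    contMDiffAt_normalizedAcceleration_of_ne_zero g hgR hY fun h0 ↦ hx ((hY0 x).1 h0)
  have hdivX : ∀ x, x ∉ C → g.vectorDivergence X x = S x / 2 := fun x hx ↦
    vectorDivergence_normalizedAcceleration g h2 hgR hY.contMDiffOn fun h0 ↦ hx ((hY0 x).1 h0)
  -- ### Step 2: the local data at each critical point
  have hdata : ∀ p ∈ C, ∃ T : EuclideanSpace ℝ (Fin 2) ≃L[ℝ] EuclideanSpace ℝ (Fin 2),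
      ∃ Cp r₀ : ℝ, 0 < r₀ ∧
      closedBall (extChartAt (𝓡 2) p p)
          (2 * r₀ * ‖(T.symm : EuclideanSpace ℝ (Fin 2) →L[ℝ] EuclideanSpace ℝ (Fin 2))‖) ⊆
        (extChartAt (𝓡 2) p).target ∧
      ∀ r, 0 < r → r < r₀ →
        Continuous (fun y ↦ mvfderiv (𝓡 2) (mcutoff (𝓡 2) p
          (T : EuclideanSpace ℝ (Fin 2) →L[ℝ] EuclideanSpace ℝ (Fin 2)) r) y (X y)) ∧
        |(∫ y, mvfderiv (𝓡 2) (mcutoff (𝓡 2) p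
            (T : EuclideanSpace ℝ (Fin 2) →L[ℝ] EuclideanSpace ℝ (Fin 2)) r) y (X y) ∂μ) +
          2 * π * (-1 : ℝ) ^ morseIndex (𝓡 2) f p| ≤ Cp * r := by
    intro p hp
    obtain ⟨L, hL, hsign⟩ := exists_linearization_grad G hf ((hC p).1 hp)
    obtain ⟨A₀, hA₀⟩ := exists_norm_eq_norm_symmL (I := 𝓡 2) p p
    obtain ⟨A, hA⟩ :=
      exists_continuousLinearEquiv_of_norm_eq_norm_symmL p p (mem_chart_source _ p) hA₀
    have hA' : ∀ v w, metricRep (𝓡 2) g p (extChartAt (𝓡 2) p p) v w = ⟪A v, A w⟫ := by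
      intro v w
      rw [hA v, hA w, inner_eq_inner_symmL_of_norm_eq p p hA₀ v w, metricRep_apply_eq_val_symmL,
        extChartAt_to_inv (I := 𝓡 2) p]
      rfl
    obtain ⟨Cp, r₀, hr₀, hcl, -, hflux⟩ :=
      abs_integral_mvfderiv_mcutoff_add_le G p hY ((hY0 p).2 hp) L hL A hA'
    refine ⟨L.trans A, Cp, r₀, hr₀, hcl, fun r hr hrr ↦ ?_⟩
    obtain ⟨hc, hb⟩ := hflux r hr hrr
    rw [hsign] at hb
    exact ⟨hc, hb⟩
  choose! T Cst r₀ hr₀ hcl hflux using hdata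
  -- bounds for the density near each critical point, and for the scalar curvature
  have hdens : ∀ p ∈ C, ∃ B : ℝ, 0 ≤ B ∧ ∀ e ∈ closedBall (extChartAt (𝓡 2) p p)
      (2 * r₀ p * ‖((T p).symm : EuclideanSpace ℝ (Fin 2) →L[ℝ] EuclideanSpace ℝ (Fin 2))‖),
      Real.sqrt (chartGramMatrix G p e).det ≤ B := by
    intro p hp
    obtain ⟨B, hB⟩ := (isCompact_closedBall _ _).exists_bound_of_continuousOn
      ((contDiffOn_sqrt_det_chartGramMatrix G p).continuousOn.mono (hcl p hp))
    refine ⟨max B 0, le_max_right _ _, fun e he ↦ ?_⟩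
    exact ((le_abs_self _).trans (((Real.norm_eq_abs _).symm.le).trans (hB e he))).trans
      (le_max_left _ _)
  choose! B hB0 hB using hdens
  obtain ⟨MS₀, hMS₀⟩ := isCompact_univ.exists_bound_of_continuousOn hSc.continuousOn
  set MS : ℝ := max MS₀ 0 with hMSdef
  have hMS : ∀ y, |S y| ≤ MS := fun y ↦
    ((Real.norm_eq_abs _).symm.le.trans (hMS₀ y (mem_univ _))).trans (le_max_left _ _)
  have hMS0 : 0 ≤ MS := le_max_right _ _
  -- ### Step 3: separate the critical points and choose a common small radius
  obtain ⟨U, hU, hUdisj⟩ := hCfin.t2_separation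
  have hε : ∀ p ∈ C, ∃ ε : ℝ, 0 < ε ∧
      ∀ e ∈ ball (extChartAt (𝓡 2) p p) ε, (extChartAt (𝓡 2) p).symm e ∈ U p := by
    intro p _
    have h2' : (extChartAt (𝓡 2) p).symm ⁻¹' U p ∈ 𝓝 (extChartAt (𝓡 2) p p) := by
      refine (continuousAt_extChartAt_symm p).preimage_mem_nhds ?_
      rw [extChartAt_to_inv]
      exact (hU p).2.mem_nhds (hU p).1
    obtain ⟨ε, hε, hball⟩ := Metric.mem_nhds_iff.1 h2'
    exact ⟨ε, hε, fun e he ↦ hball he⟩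
  choose! ε hε hεU using hε
  set nT : M → ℝ := fun p ↦
    ‖((T p).symm : EuclideanSpace ℝ (Fin 2) →L[ℝ] EuclideanSpace ℝ (Fin 2))‖ with hnT
  have hnT0 : ∀ p, 0 ≤ nT p := fun p ↦ norm_nonneg _
  set ρr : M → ℝ := fun p ↦ min (r₀ p) (ε p / (2 * (nT p + 1))) with hρr
  have hρpos : ∀ p ∈ C, 0 < ρr p := fun p hp ↦
    lt_min (hr₀ p hp) (div_pos (hε p hp) (by have := hnT0 p; positivity))
  obtain ⟨r₁, hr₁, hr₁1, hr₁C⟩ : ∃ r₁ : ℝ, 0 < r₁ ∧ r₁ ≤ 1 ∧ ∀ p ∈ C, r₁ ≤ ρr p := by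
    refine ⟨(insert 1 (C.image ρr)).min' (Finset.insert_nonempty _ _), ?_,
      Finset.min'_le _ _ (Finset.mem_insert_self _ _),
      fun p hp ↦ Finset.min'_le _ _ (Finset.mem_insert_of_mem (Finset.mem_image_of_mem _ hp))⟩
    have hmem := (insert 1 (C.image ρr)).min'_mem (Finset.insert_nonempty _ _)
    rcases Finset.mem_insert.1 hmem with h | h
    · rw [h]; exact one_pos
    · obtain ⟨p, hp, hpe⟩ := Finset.mem_image.1 h
      rw [← hpe]; exact hρpos p hp
  -- ### Step 4: the main estimate for `0 < r < r₁`
  set K₁ : ℝ := ∑ p ∈ C, Cst p with hK₁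
  set K₂ : ℝ := MS / 2 * ∑ p ∈ C, B p * (π * (2 * nT p) ^ 2) with hK₂
  set σ : ℝ := ∑ p ∈ C, (-1 : ℝ) ^ morseIndex (𝓡 2) f p with hσ
  have hkey : ∀ r, 0 < r → r < r₁ → |(∫ x, S x / 2 ∂μ) - 2 * π * σ| ≤ (K₁ + K₂) * r := by
    intro r hr hrr₁
    -- facts at each critical point
    have hrr₀ : ∀ p ∈ C, r < r₀ p := fun p hp ↦
      (hrr₁.trans_le (hr₁C p hp)).trans_le (min_le_left _ _)
    have hrε : ∀ p ∈ C, 2 * r * nT p < ε p := by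
      intro p hp
      have h1 : r < ε p / (2 * (nT p + 1)) := (hrr₁.trans_le (hr₁C p hp)).trans_le (min_le_right _ _)
      rw [lt_div_iff₀ (by have := hnT0 p; positivity)] at h1
      nlinarith [hnT0 p]
    have hclr : ∀ p ∈ C, closedBall (extChartAt (𝓡 2) p p) (2 * r * nT p) ⊆
        (extChartAt (𝓡 2) p).target := fun p hp ↦
      (closedBall_subset_closedBall (by have := hnT0 p; have := hrr₀ p hp; nlinarith)).trans
        (hcl p hp)
    have hKU : ∀ p ∈ C, mcutoffSupport (𝓡 2) p (T p) r ⊆ U p := by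
      rintro p hp _ ⟨e, he, rfl⟩
      exact hεU p hp e (closedBall_subset_ball (hrε p hp) he)
    have hKdisj : ∀ p ∈ C, ∀ q ∈ C, q ≠ p → ∀ y ∈ mcutoffSupport (𝓡 2) p (T p) r,
        y ∉ mcutoffSupport (𝓡 2) q (T q) r := by
      intro p hp q hq hqp y hyp hyq
      have hd := hUdisj ((hC p).1 hp) ((hC q).1 hq) (Ne.symm hqp)
      exact Set.disjoint_left.1 hd (hKU p hp hyp) (hKU q hq hyq)
    -- the global cutoff `χ = ∏_p χ_p`
    set m : M → M → ℝ := fun p ↦ mcutoff (𝓡 2) p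
      ((T p : EuclideanSpace ℝ (Fin 2) ≃L[ℝ] EuclideanSpace ℝ (Fin 2)) :
        EuclideanSpace ℝ (Fin 2) →L[ℝ] EuclideanSpace ℝ (Fin 2)) r with hm
    set χ : M → ℝ := fun y ↦ ∏ p ∈ C, m p y with hχ
    have hms : ∀ p ∈ C, ContMDiff (𝓡 2) 𝓘(ℝ, ℝ) ∞ (m p) := fun p hp ↦
      contMDiff_mcutoff p (T p) hr (hclr p hp)
    have hχs : ContMDiff (𝓡 2) 𝓘(ℝ, ℝ) ∞ χ := contMDiff_finsetProd hms
    have hχ0 : ∀ p ∈ C, χ =ᶠ[𝓝 p] fun _ ↦ 0 := by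
      intro p hp
      filter_upwards [mcutoff_eventuallyEq_zero (I := 𝓡 2) p
        ((T p : EuclideanSpace ℝ (Fin 2) ≃L[ℝ] EuclideanSpace ℝ (Fin 2)) :
          EuclideanSpace ℝ (Fin 2) →L[ℝ] EuclideanSpace ℝ (Fin 2)) r] with y hy
      exact Finset.prod_eq_zero hp hy
    have hχ1 : ∀ y, (∀ q ∈ C, y ∉ mcutoffSupport (𝓡 2) q (T q) r) → χ =ᶠ[𝓝 y] fun _ ↦ 1 := by
      intro y hy
      have hev : ∀ᶠ z in 𝓝 y, ∀ q ∈ C, m q z = 1 :=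
        (Filter.eventually_all_finset C).2 fun q hq ↦
          mcutoff_eventuallyEq_one q (T q) hr (hclr q hq) (hy q hq)
      filter_upwards [hev] with z hz
      exact Finset.prod_eq_one hz
    have hχp : ∀ p ∈ C, ∀ y ∈ mcutoffSupport (𝓡 2) p (T p) r, χ =ᶠ[𝓝 y] m p := by
      intro p hp y hy
      have hev : ∀ᶠ z in 𝓝 y, ∀ q ∈ C.erase p, m q z = 1 :=
        (Filter.eventually_all_finset (C.erase p)).2 fun q hq ↦
          mcutoff_eventuallyEq_one q (T q) hr (hclr q (Finset.mem_of_mem_erase hq))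
            (hKdisj p hp q (Finset.mem_of_mem_erase hq) (Finset.ne_of_mem_erase hq) y hy)
      filter_upwards [hev] with z hz
      show ∏ q ∈ C, m q z = m p z
      rw [← Finset.mul_prod_erase C _ hp, Finset.prod_eq_one hz, mul_one]
    -- the fluxes `u_p = dχ_p(X)` and `dχ(X) = Σ_p u_p`
    set uf : M → M → ℝ := fun p y ↦ mvfderiv (𝓡 2) (m p) y (X y) with huf
    have hu0 : ∀ p ∈ C, ∀ y, y ∉ mcutoffSupport (𝓡 2) p (T p) r → uf p y = 0 := by
      intro p hp y hy
      simp only [huf, hm]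
      rw [mvfderiv_mcutoff_eq_zero p (T p) hr (hclr p hp) hy, _root_.zero_apply]
    have hdχ : ∀ y, mvfderiv (𝓡 2) χ y (X y) = ∑ p ∈ C, uf p y := by
      intro y
      by_cases hyK : ∃ p ∈ C, y ∈ mcutoffSupport (𝓡 2) p (T p) r
      · obtain ⟨p, hp, hyp⟩ := hyK
        rw [mvfderiv_congr_of_eventuallyEq' (hχp p hp y hyp), Finset.sum_eq_single_of_mem p hp]
        intro q hq hqp
        exact hu0 q hq y (hKdisj p hp q hq hqp y hyp)
      · push Not at hyK
        rw [mvfderiv_congr_of_eventuallyEq' (hχ1 y hyK), Finset.sum_eq_zero fun q hq ↦ hu0 q hq y (hyK q hq)]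
        simp [mvfderiv_real_apply, mfderiv_const]
    -- the cut-off field `W = χ X` is smooth
    have hW : ContMDiff (𝓡 2) ((𝓡 2).prod 𝓘(ℝ, EuclideanSpace ℝ (Fin 2))) ∞ fun y ↦
        (TotalSpace.mk' (EuclideanSpace ℝ (Fin 2)) y ((χ • X) y) : TangentBundle (𝓡 2) M) := by
      intro y
      by_cases hyC : y ∈ C
      · refine (contMDiffAt_zeroSection ℝ
          (TangentSpace (𝓡 2) : M → Type _)).congr_of_eventuallyEq ?_
        filter_upwards [hχ0 y hyC] with z hz
        show TotalSpace.mk' (EuclideanSpace ℝ (Fin 2)) z (χ z • X z) = ⟨z, 0⟩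
        rw [hz, zero_smul]
      · exact (hχs y).smul_section (hXs y hyC)
    -- divergence of `W`: `div W = χ S/2 + Σ_p u_p`
    have hdivW : ∀ y, g.vectorDivergence (χ • X) y = χ y * (S y / 2) + ∑ p ∈ C, uf p y := by
      intro y
      by_cases hyC : y ∈ C
      · have h0 : ∀ᶠ z in 𝓝 y, (χ • X) z = 0 := by
          filter_upwards [hχ0 y hyC] with z hz
          show χ z • X z = 0
          rw [hz, zero_smul]
        have hχy : χ y = 0 := (hχ0 y hyC).self_of_nhds
        have hd0 : mvfderiv (𝓡 2) χ y (X y) = 0 := by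
          rw [mvfderiv_congr_of_eventuallyEq' (hχ0 y hyC)]
          simp [mvfderiv_real_apply, mfderiv_const]
        rw [vectorDivergence_eq_zero_of_eventuallyEq_zero h0, ← hdχ y, hχy, hd0]
        ring
      · rw [vectorDivergence_smul ((hXs y hyC).mdifferentiableAt (by simp))
          ((hχs y).mdifferentiableAt (by simp)), hdivX y hyC, hdχ y]
    -- the divergence theorem
    obtain ⟨-, hint0⟩ := integral_vectorDivergence_eq_zero G
      (hW.of_le (by exact_mod_cast (le_top : (1 : ℕ∞) ≤ ⊤)))
    have hχSc : Continuous fun y ↦ χ y * (S y / 2) := hχs.continuous.mul (hSc.div_const _)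
    have hχSi : Integrable (fun y ↦ χ y * (S y / 2)) μ := integrable_of_continuous G hχSc
    have hui : ∀ p ∈ C, Integrable (uf p) μ := fun p hp ↦
      integrable_of_continuous G (hflux p hp r hr (hrr₀ p hp)).1
    have hsplit : (∫ y, χ y * (S y / 2) ∂μ) = -∑ p ∈ C, ∫ y, uf p y ∂μ := by
      have h1 : ∫ y, g.vectorDivergence (χ • X) y ∂μ =
          (∫ y, χ y * (S y / 2) ∂μ) + ∑ p ∈ C, ∫ y, uf p y ∂μ := by
        rw [integral_congr_ae (ae_of_all _ hdivW), integral_add hχSi (integrable_finsetSum _ hui),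
          integral_finsetSum _ hui]
      rw [h1] at hint0
      linarith
    -- the flux estimate
    have hfluxsum : |(∑ p ∈ C, ∫ y, uf p y ∂μ) + 2 * π * σ| ≤ K₁ * r := by
      have : (∑ p ∈ C, ∫ y, uf p y ∂μ) + 2 * π * σ =
          ∑ p ∈ C, ((∫ y, uf p y ∂μ) + 2 * π * (-1 : ℝ) ^ morseIndex (𝓡 2) f p) := by
        rw [hσ, Finset.mul_sum, ← Finset.sum_add_distrib]
      rw [this, hK₁, Finset.sum_mul]
      exact (Finset.abs_sum_le_sum_abs _ _).trans (Finset.sum_le_sum fun p hp ↦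
        (hflux p hp r hr (hrr₀ p hp)).2)
    -- the cutoff error: `|∫ (1 - χ) S/2| ≤ K₂ r`
    have hχ01 : ∀ y, 0 ≤ χ y ∧ χ y ≤ 1 := fun y ↦
      ⟨Finset.prod_nonneg fun p _ ↦ mcutoff_nonneg _ _ _ _,
        Finset.prod_le_one (fun p _ ↦ mcutoff_nonneg _ _ _ _) fun p _ ↦ mcutoff_le_one _ _ _ _⟩
    have hKm : ∀ p ∈ C, MeasurableSet (mcutoffSupport (𝓡 2) p (T p) r) := fun p hp ↦
      (isCompact_mcutoffSupport p (T p) (hclr p hp)).isClosed.measurableSet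
    have herr : |(∫ y, S y / 2 ∂μ) - ∫ y, χ y * (S y / 2) ∂μ| ≤ K₂ * r := by
      have hSi : Integrable (fun y ↦ S y / 2) μ := integrable_of_continuous G (hSc.div_const _)
      rw [← integral_sub hSi hχSi]
      -- pointwise bound by a sum of indicators
      set ind : M → ℝ := fun y ↦ ∑ p ∈ C, (mcutoffSupport (𝓡 2) p (T p) r).indicator
        (fun _ ↦ (1 : ℝ)) y with hind
      have hptw : ∀ y, |S y / 2 - χ y * (S y / 2)| ≤ MS / 2 * ind y := by
        intro y
        have hS : |S y| ≤ MS := hMS y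
        by_cases hyK : ∃ p ∈ C, y ∈ mcutoffSupport (𝓡 2) p (T p) r
        · obtain ⟨p, hp, hyp⟩ := hyK
          have h1 : (1 : ℝ) ≤ ind y := by
            rw [hind]
            dsimp only
            rw [← Finset.add_sum_erase C _ hp, indicator_of_mem hyp]
            have : 0 ≤ ∑ q ∈ C.erase p, (mcutoffSupport (𝓡 2) q (T q) r).indicator
                (fun _ ↦ (1 : ℝ)) y :=
              Finset.sum_nonneg fun q _ ↦ indicator_nonneg (fun _ _ ↦ zero_le_one) _
            linarith
          have h3 : |S y / 2 - χ y * (S y / 2)| = (1 - χ y) * (|S y| / 2) := by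
            rw [show S y / 2 - χ y * (S y / 2) = (1 - χ y) * (S y / 2) by ring, abs_mul,
              abs_of_nonneg (by linarith [(hχ01 y).2]), abs_div, abs_two]
          rw [h3]
          calc (1 - χ y) * (|S y| / 2) ≤ 1 * (MS / 2) :=
                mul_le_mul (by linarith [(hχ01 y).1]) (by linarith [hS]) (by positivity)
                  zero_le_one
            _ ≤ MS / 2 * ind y := by rw [one_mul]; nlinarith [hMS0, h1]
        · push Not at hyK
          have hχy : χ y = 1 := (hχ1 y hyK).self_of_nhds
          have h0 : ind y = 0 := Finset.sum_eq_zero fun q hq ↦ indicator_of_notMem (hyK q hq) _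
          rw [hχy, h0, one_mul, sub_self, abs_zero, mul_zero]
      have hindi : Integrable ind μ := by
        haveI := isFiniteMeasure_riemannianMeasure G
        exact integrable_finsetSum _ fun p hp ↦ (integrable_const (1 : ℝ)).indicator (hKm p hp)
      have hI : |∫ y, S y / 2 - χ y * (S y / 2) ∂μ| ≤ ∫ y, MS / 2 * ind y ∂μ := by
        refine (abs_integral_le_integral_abs).trans (integral_mono_of_nonneg
          (ae_of_all _ fun y ↦ abs_nonneg _) (hindi.const_mul _) (ae_of_all _ hptw))
      refine hI.trans ?_
      rw [integral_const_mul]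
      have hsum : ∫ y, ind y ∂μ =
          ∑ p ∈ C, ∫ y, (mcutoffSupport (𝓡 2) p (T p) r).indicator (fun _ ↦ (1 : ℝ)) y ∂μ := by
        simp only [hind]
        haveI := isFiniteMeasure_riemannianMeasure G
        exact integral_finsetSum _ fun p hp ↦ (integrable_const (1 : ℝ)).indicator (hKm p hp)
      rw [hsum]
      have hmeas : ∀ p ∈ C, ∫ y, (mcutoffSupport (𝓡 2) p (T p) r).indicator (fun _ ↦ (1 : ℝ)) y ∂μ
          ≤ B p * (π * (2 * nT p) ^ 2) * r := by
        intro p hp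
        have hio : ∫ y, (mcutoffSupport (𝓡 2) p (T p) r).indicator (fun _ ↦ (1 : ℝ)) y ∂μ =
            μ.real (mcutoffSupport (𝓡 2) p (T p) r) :=
          integral_indicator_one (hKm p hp)
        rw [hio]
        have h1 := measureReal_mcutoffSupport_le G p (T p) hr.le
          (show 2 * r * nT p ≤ 2 * r₀ p * nT p by
            have := hnT0 p; have := hrr₀ p hp; nlinarith) (hcl p hp) (hB p hp)
        calc μ.real (mcutoffSupport (𝓡 2) p (T p) r) ≤ B p * (π * (2 * r * nT p) ^ 2) := h1
          _ = B p * (π * (2 * nT p) ^ 2) * r * r := by ring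
          _ ≤ B p * (π * (2 * nT p) ^ 2) * r * 1 := by
              have := hB0 p hp
              have := hnT0 p
              exact mul_le_mul_of_nonneg_left (hrr₁.le.trans hr₁1) (by positivity)
          _ = B p * (π * (2 * nT p) ^ 2) * r := mul_one _
      rw [hK₂]
      calc MS / 2 * ∑ p ∈ C, ∫ y, (mcutoffSupport (𝓡 2) p (T p) r).indicator (fun _ ↦ (1 : ℝ)) y ∂μ
          ≤ MS / 2 * ∑ p ∈ C, B p * (π * (2 * nT p) ^ 2) * r :=
            mul_le_mul_of_nonneg_left (Finset.sum_le_sum fun p hp ↦ hmeas p hp)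
              (by linarith [hMS0])
        _ = MS / 2 * (∑ p ∈ C, B p * (π * (2 * nT p) ^ 2)) * r := by
            rw [← Finset.sum_mul]; ring
    -- combine
    calc |(∫ x, S x / 2 ∂μ) - 2 * π * σ|
        = |((∫ y, S y / 2 ∂μ) - ∫ y, χ y * (S y / 2) ∂μ) -
            ((∑ p ∈ C, ∫ y, uf p y ∂μ) + 2 * π * σ)| := by
          rw [hsplit]; congr 1; ring
      _ ≤ |(∫ y, S y / 2 ∂μ) - ∫ y, χ y * (S y / 2) ∂μ| +
            |(∑ p ∈ C, ∫ y, uf p y ∂μ) + 2 * π * σ| := abs_sub _ _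
      _ ≤ K₂ * r + K₁ * r := add_le_add herr hfluxsum
      _ = (K₁ + K₂) * r := by ring
  -- ### Step 5: conclusion
  have hhalf : (∫ x, S x / 2 ∂μ) = 2 * π * σ := eq_of_abs_sub_le_mul hr₁ hkey
  have hσχ : σ = (relEuler ℤ ℤ M ∅ : ℝ) := sum_neg_one_pow_morseIndex_eq_relEuler hf hCfin
  have hS2 : (∫ x, S x ∂μ) = 2 * ∫ x, S x / 2 ∂μ := by
    rw [← integral_const_mul]
    refine integral_congr_ae (ae_of_all _ fun x ↦ ?_)
    ring
  rw [hS2, hhalf, hσχ]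
  ring

/-- **The Gauss–Bonnet theorem, Riemannian-volume form**: for a smooth Mathlib Riemannian metric
`G` on a compact surface, `∫_M S d(riemannianVolume G 2) = 4π χ(M)`.
[cite: LeeRiemannianManifolds2018, Thm. 9.7 (with Cor. 8.28)] -/
theorem integral_scalarCurvature_eq_relEuler
    (G : ContMDiffRiemannianMetric (𝓡 2) ∞ (EuclideanSpace ℝ (Fin 2))
      (TangentSpace (𝓡 2) : M → Type _)) [(ofRiemannian G).HasLeviCivita] :
    ∫ x, (ofRiemannian G).scalarCurvature x ∂(riemannianVolume G 2) =
      4 * π * (relEuler ℤ ℤ M ∅ : ℝ) := by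
  rw [← riemannianMeasure_eq_riemannianVolume G]
  exact integral_scalarCurvature_riemannianMeasure_eq G

/-- **The Gauss–Bonnet theorem** (Lee, *Introduction to Riemannian Manifolds* (2018), Thm. 9.7,
with Cor. 8.28, `K = S/2`, and `χ(M) = Σ_k (-1)^k rank H_k(M; ℤ)`): for every compact Hausdorff
`2`-manifold `M` modelled on `ℝ²` and every smooth Riemannian `PseudoRiemannianMetric` `g` on
`TM`, `∫_M S_g dA_g = 4π χ(M)`, with `dA_g = riemannianVolume (g.toContMDiffRiemannianMetric hg) 2`
and `χ(M) = relEuler ℤ ℤ M ∅`. [cite: LeeRiemannianManifolds2018, Thm. 9.7 (with pp. 276–277 and Cor. 8.28)] -/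
theorem gaussBonnet
    (g : PseudoRiemannianMetric (𝓡 2) ∞ (EuclideanSpace ℝ (Fin 2))
      (TangentSpace (𝓡 2) : M → Type _)) [hLC : g.HasLeviCivita] (hg : g.IsRiemannian) :
    ∫ x, g.scalarCurvature x ∂(riemannianVolume (g.toContMDiffRiemannianMetric hg) 2) =
      4 * π * (relEuler ℤ ℤ M ∅ : ℝ) := by
  have hgg : ofRiemannian (g.toContMDiffRiemannianMetric hg) = g := rfl
  haveI : (ofRiemannian (g.toContMDiffRiemannianMetric hg)).HasLeviCivita := hLC
  exact integral_scalarCurvature_eq_relEuler (g.toContMDiffRiemannianMetric hg)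

/-- **Gauss–Bonnet bound for compact connected surfaces: `∫_M S dA ≤ 8π`** (`χ(M) ≤ 2` for a
closed connected surface, `relEuler_surface_le_two`). This is "`∫_{N_t} 2K = 4πχ(N_t) ≤ 8π`
provided that `N_t` is connected" of Huisken–Ilmanen 2001, §5, Monotonicity Calculation.
[cite: LeeRiemannianManifolds2018, Thm. 9.7 and pp. 277–278 (χ ≤ 2 for compact connected surfaces)] -/
theorem integral_scalarCurvature_le [ConnectedSpace M]
    (g : PseudoRiemannianMetric (𝓡 2) ∞ (EuclideanSpace ℝ (Fin 2))
      (TangentSpace (𝓡 2) : M → Type _)) [g.HasLeviCivita] (hg : g.IsRiemannian) :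
    ∫ x, g.scalarCurvature x ∂(riemannianVolume (g.toContMDiffRiemannianMetric hg) 2) ≤ 8 * π := by
  haveI : Nonempty M := ConnectedSpace.toNonempty
  have hχ : (relEuler ℤ ℤ M ∅ : ℝ) ≤ 2 := by
    exact_mod_cast Literature.Topology.FourManifolds.relEuler_surface_le_two (S := M)
  rw [gaussBonnet g hg]
  nlinarith [Real.pi_pos]

/-- **Gauss–Bonnet bound for a Mathlib Riemannian metric**: for a smooth
`ContMDiffRiemannianMetric` `G` on a compact connected surface, `∫_M S dA ≤ 8π` with `S` the scalar
curvature of `ofRiemannian G` and `dA = riemannianVolume G 2`. This is the form consumed by induced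
metrics of immersed surfaces, e.g. the leaves of an inverse mean curvature flow (Huisken–Ilmanen
2001, §5). [cite: LeeRiemannianManifolds2018, Thm. 9.7 and pp. 277–278 (χ ≤ 2 for compact connected surfaces)] -/
theorem integral_scalarCurvature_ofRiemannian_le [ConnectedSpace M]
    (G : ContMDiffRiemannianMetric (𝓡 2) ∞ (EuclideanSpace ℝ (Fin 2))
      (TangentSpace (𝓡 2) : M → Type _)) [(ofRiemannian G).HasLeviCivita] :
    ∫ x, (ofRiemannian G).scalarCurvature x ∂(riemannianVolume G 2) ≤ 8 * π := by
  haveI : Nonempty M := ConnectedSpace.toNonempty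
  have hχ : (relEuler ℤ ℤ M ∅ : ℝ) ≤ 2 := by
    exact_mod_cast Literature.Topology.FourManifolds.relEuler_surface_le_two (S := M)
  rw [integral_scalarCurvature_eq_relEuler G]
  nlinarith [Real.pi_pos]

end GaussBonnet

end Literature.Geometry.Riemannian

end
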